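import Literature.IUT.HodgeTheaters.GoodLocalFrobenioidOfKitQpLattice
import Literature.IUT.HodgeTheaters.GoodLocalFrobenioidOfKitBases
import Literature.IUT.HodgeTheaters.ReconstructibleAlongCriterion
import Literature.IUT.HodgeTheaters.GoodLocalFrobenioidOfKitQpReconstruction
import Literature.AlgebraicGeometry.Frobenioids.Thm34SubStdHyp
import Literature.AlgebraicGeometry.Frobenioids.PadicFrobenioidQpSplit
import HarnessLib

/-!
# [IUTchI] Example 3.3 (iii) (d) HOLDS at the real instance `GoodLocalFrobenioid.ofKitQp p`:
# `C⊢_v` is reconstructible from `F̲_v = C_v` ([FrdI] Thm. 3.4 (iii): isometries and Frobenius degrees are categorical)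

Mochizuki, *Inter-universal Teichmüller theory I*, §3, Example 3.3 (iii) (d), kurims May-2020 manuscript p. 79
[claim: Mochizuki2012, status: disputed]: "(d) the category `C⊢_v` may be reconstructed category-theoretically from `F̲_v`
[cf. [FrdI], Corollary 4.11, (iii); [FrdII], Theorem 1.2, (i); (a), (c) above]"; Mochizuki, *The geometry of Frobenioids I*,
Kyushu J. Math. **62** (2008), Thm. 3.4 (iii) p. 62 [cite: MochizukiFrdI2008, Thm. 3.4 (iii) p.62] ("`Ψ` preserves …
isometries … there exists a [unique] automorphism `Ψ^{ℕ≥1}` … equal to the identity"). abc-iut cell, seat abc-iut-w4-d047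
(gen 2); DAG node `IUTchI:Ex3.3(iii)`, row E33iii/d of `plan/L5/SUBDAG-IUTchI-Ex33-Ex34.md`.

abc-iut-L5-t2 typed (d) as `GoodLocalFrobenioid.CdashFromF G := ReconstructibleAlong G.CdashToC` (Rmk. 3.2.1 (i) reading:
every self-equivalence of `C_v` lifts, compatibly, along `C⊢_v ⊆ C_v` to a self-equivalence of `C⊢_v`). THIS FILE proves
`(GoodLocalFrobenioid.ofKitQp p).CdashFromF` for every prime `p` — at abc-iut-L5-t2's REAL instance over the one-object base,
where `C_v = C(ℚ_p)`, `C⊢_v = C⊢(ℚ_p)` are abc-iut-L1-t4's [FrdII] Ex. 1.1 (ii) model Frobenioids — from layer L1's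
kernel theorems only (no anabelian input):

1. `cdashToC_full` — at `K_v = ℚ_p` the inclusion `C⊢_v ⊆ C_v` is FULL (it is faithful by construction): `B⊢ = B`
   (every `x ∈ ℚ_pˣ` has `Div₀(x) ∈ ℤ·ord(p)`) and a morphism between objects of integral class has integral zero divisor
   (`GoodLocalFrobenioidOfKitQpLattice.lean`: `Div_B(B) = ℤ·log(p)`; sharpness of `ord(ℤ_p^▷)^pf` for the sign);
2. `essImage_invariant` — every self-equivalence `e` of `C_v` maps the image of `C⊢_v` (the objects of class in `ℤ·log(p)`)
   into itself: an image object carries an ISOMETRIC endomorphism of Frobenius degree `2`; by [FrdI] Thm. 3.4 (iii) over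
   FSM-type bases (abc-iut-L1's `FrdI.Thm34Sub.l01_morphismsPreserved_FSM_holds` — isometries preserved — and
   `l07_psiN_nonGroupLike_holds` — `Ψ^{ℕ≥1} = id`; hypotheses by `padicFrobenioid_stdHyp`, [FrdII] Thm. 1.2 (i)) so does
   its image, whose class is therefore `Div_B(u) ∈ ℤ·log(p)` ([FrdI] Thm. 5.2 (i) relation);
3. `cdashFromF_ofKitQp` — by the criterion `reconstructibleAlong_of_essImage_invariant` (`ReconstructibleAlongCriterion.lean`).

NET at the witness `ofKitQp p` (with `GoodLocalFrobenioidOfKitQpReconstruction.lean`, `GoodLocalFrobenioidOfKitSplitNegative.lean`):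
clauses (a)(b)(c)(d) of Ex. 3.3 (iii) HOLD and (e) FAILS — exactly the clause whose printed justification invokes anabelian
input ([AbsTopIII] Prop. 3.2 (iii)) is the one the degenerate base cannot supply (`ex33iii_abcd_not_e_ofKitQp`).
Nothing of the disputed series is asserted; typed ≠ proved; no side is taken on [IUTchIII] Cor. 3.12.
-/

noncomputable section

namespace Literature.IUT.HodgeTheaters

namespace GoodLocalFrobenioid

open CategoryTheory Opposite Literature.AlgebraicGeometry.Frobenioids Literature.AlgebraicGeometry.Frobenioids.PadicFrd

variable (p : ℕ) [Fact p.Prime]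

/-! ### Classes of image objects -/

/-- Pull-back of divisor classes along an arrow of the one-object base is the identity. [cite: MochizukiFrdI2008, Thm. 5.2(i) p.100] -/
theorem pullGp_eq_self_qp {b : Discrete PUnit.{1}} (f : b ⟶ b)
    (c : Algebra.GrothendieckGroup ((qpPerfDatum p).Φ.obj (op b))) : pullGp (qpPerfDatum p).Φ f c = c := by
  rw [Subsingleton.elim f (𝟙 b)]
  exact pullGp_id b c

/-- The same for `C⊢_v`. [cite: MochizukiFrdI2008, Thm. 5.2(i) p.100] -/
theorem pullGp_eq_self_qp' {b : Discrete PUnit.{1}} (f : b ⟶ b)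
    (c : Algebra.GrothendieckGroup ((qpPrimDatum p).Φ.obj (op b))) : pullGp (qpPrimDatum p).Φ f c = c := by
  rw [Subsingleton.elim f (𝟙 b)]
  exact pullGp_id b c

/-- The class of the image of `X ∈ C⊢_v` in `C_v` is `log(p)^i` where `X` has class `log(p)^i`.
[cite: MochizukiFrdII2008, Ex 1.1 (ii) p.8] -/
theorem cdashToC_obj_cls_eq_zpow (X : (qpPrimDatum p).frobenioid) {i : ℤ}
    (hi : X.cls = Algebra.GrothendieckGroup.of (logpQ p X.base) ^ i) :
    ((ofKitQp p).CdashToC.obj X).cls = Algebra.GrothendieckGroup.of (pGen p X.base) ^ i := by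
  rw [cdashToC_obj_cls, hi, gpApp_η_logpQ_zpow]

/-! ### `C⊢_v ⊆ C_v` is full at `K_v = ℚ_p` -/

/-- A nonnegative power of `log(p)` in `Φ_{C_v}(A)^gp` that is the class of an element `z` of the (sharp) monoid
`Φ_{C_v}(A)` has nonnegative exponent, and then `z = log(p)^n`. [cite: MochizukiFrdII2008, Ex 1.1 (ii) p.8] -/
theorem eq_pGen_pow_of_of_eq_zpow (A : Discrete PUnit.{1}) (z : (qpPerfDatum p).Φ.obj (op A)) (m : ℤ)
    (hz : Algebra.GrothendieckGroup.of z = Algebra.GrothendieckGroup.of (pGen p A) ^ m) :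
    ∃ n : ℕ, (m = n) ∧ z = pGen p A ^ n := by
  haveI : IsCancelMul ((qpPerfDatum p).Φ.obj (op A)) := ((qpPerfDatum p).isMonoprime (op A)).isCancelMul
  rcases Int.eq_nat_or_neg m with ⟨n, rfl | rfl⟩
  · refine ⟨n, rfl, Algebra.GrothendieckGroup.of_injective ?_⟩
    rw [hz, zpow_natCast, map_pow]
  · -- negative exponent: `z · log(p)^n = 1` in a sharp monoid forces `n = 0`
    have h1 : Algebra.GrothendieckGroup.of (z * pGen p A ^ n) = 1 := by
      rw [map_mul, hz, map_pow, zpow_neg, zpow_natCast, inv_mul_cancel]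
    have h2 : z * pGen p A ^ n = 1 := Algebra.GrothendieckGroup.of_injective (h1.trans (map_one _).symm)
    have hsharp : IsSharp ((qpPerfDatum p).Φ.obj (op A)) := ((qpPerfDatum p).isMonoprime (op A)).isSharp
    rcases Nat.eq_zero_or_pos n with hn | hn
    · subst hn
      refine ⟨0, by simp, ?_⟩
      rw [pow_zero] at h2 ⊢
      rw [mul_one] at h2
      exact h2
    · exfalso
      have hu : IsUnit (pGen p A) := (isUnit_pow_iff hn.ne').mp (IsUnit.of_mul_eq_one_right _ h2)
      have hg1 : pGen p A = 1 := hsharp.1 _ hu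
      have hg : (qpPerfDatum p).ιHom A (pGen p A) = 1 := by rw [hg1, map_one]
      rw [ιHom_pGen] at hg
      exact primGen_ne_one (𝟭 (Discrete PUnit.{1}) ⋙ qpBase p) (A := A) (isPadicLocal_qpFld p) hg

/-- **`C⊢_v ⊆ C_v` of `ofKitQp p` is full**: every morphism of `C_v = C(ℚ_p)` between image objects comes from
`C⊢_v = C⊢(ℚ_p)` — its rational function lies in `B⊢ = B` and its zero divisor is an (integral, nonnegative) power of
`log(p)`. [cite: MochizukiFrdII2008, Ex 1.1 (ii) p.8] -/
theorem cdashToC_full : (ofKitQp p).CdashToC.Full where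
  map_surjective {X X'} g := by
    obtain ⟨⟨⟨⟩⟩, cX⟩ := X
    obtain ⟨⟨⟨⟩⟩, cX'⟩ := X'
    -- notation
    set P : Algebra.GrothendieckGroup ((qpPerfDatum p).Φ.obj (op ⟨PUnit.unit⟩)) :=
      Algebra.GrothendieckGroup.of (pGen p ⟨PUnit.unit⟩) with hP
    set L : Algebra.GrothendieckGroup ((qpPrimDatum p).Φ.obj (op ⟨PUnit.unit⟩)) :=
      Algebra.GrothendieckGroup.of (logpQ p ⟨PUnit.unit⟩) with hL
    obtain ⟨i, hi⟩ := prim_gp_eq_zpow p ⟨PUnit.unit⟩ cX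
    obtain ⟨i', hi'⟩ := prim_gp_eq_zpow p ⟨PUnit.unit⟩ cX'
    have hcls : ((ofKitQp p).CdashToC.obj ⟨⟨PUnit.unit⟩, cX⟩).cls = P ^ i :=
      cdashToC_obj_cls_eq_zpow p ⟨⟨PUnit.unit⟩, cX⟩ hi
    have hcls' : ((ofKitQp p).CdashToC.obj ⟨⟨PUnit.unit⟩, cX'⟩).cls = P ^ i' :=
      cdashToC_obj_cls_eq_zpow p ⟨⟨PUnit.unit⟩, cX'⟩ hi'
    -- the rational function of `g`, its valuation `k`, and `Div_B(u_g) = log(p)^k`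
    set k : ℤ := Multiplicative.toAdd (unitsVal p (rfQ p ⟨PUnit.unit⟩ (ModelFrobenioid.unit g))) with hk
    have hdivB : Literature.AlgebraicGeometry.Frobenioids.divB (qpPerfDatum p).Φ (qpPerfDatum p).B (qpPerfDatum p).divB
        (op ⟨PUnit.unit⟩) (ModelFrobenioid.unit g) = P ^ k := divB_eq_pGen_zpow p ⟨PUnit.unit⟩ (ModelFrobenioid.unit g)
    -- the zero divisor of `g` is `log(p)^m`
    set d : ℕ+ := ModelFrobenioid.degFr g with hd
    have hrel : (P ^ i) ^ (d : ℕ) * Algebra.GrothendieckGroup.of (ModelFrobenioid.div g) = P ^ i' * P ^ k := by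
      have h := ModelFrobenioid.rel g
      change ((ofKitQp p).CdashToC.obj ⟨⟨PUnit.unit⟩, cX⟩).cls ^ (d : ℕ) * Algebra.GrothendieckGroup.of (ModelFrobenioid.div g) =
        pullGp (qpPerfDatum p).Φ (X := ⟨PUnit.unit⟩) (Y := ⟨PUnit.unit⟩) (ModelFrobenioid.baseMap g)
          ((ofKitQp p).CdashToC.obj ⟨⟨PUnit.unit⟩, cX'⟩).cls *
        Literature.AlgebraicGeometry.Frobenioids.divB (qpPerfDatum p).Φ (qpPerfDatum p).B (qpPerfDatum p).divB
          (op ⟨PUnit.unit⟩) (ModelFrobenioid.unit g) at h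
      rw [pullGp_eq_self_qp p, hcls, hcls', hdivB] at h
      exact h
    have hz : Algebra.GrothendieckGroup.of (ModelFrobenioid.div g) = P ^ (-(i * ((d : ℕ) : ℤ)) + (i' + k)) := by
      rw [zpow_add, zpow_add, zpow_neg, zpow_mul, zpow_natCast]
      exact eq_inv_mul_of_mul_eq hrel
    obtain ⟨n, hmn, hn⟩ := eq_pGen_pow_of_of_eq_zpow p ⟨PUnit.unit⟩ (ModelFrobenioid.div g) _ hz
    -- the rational function of `g` lies in `B⊢`
    have hcompat : divZeroHom ℚ_[p] (rfQ p ⟨PUnit.unit⟩ (ModelFrobenioid.unit g)) =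
        MonGp.map ((qpPrimDatum p).ιHom ⟨PUnit.unit⟩) (L ^ k) := by
      rw [map_zpow, ← divZeroHom_pU']
      exact divZeroHom_units_qp p _
    obtain ⟨us, hus₁, hus₂⟩ := (qpPrimDatum p).exists_B_of_compat (op ⟨PUnit.unit⟩)
      (rfQ p ⟨PUnit.unit⟩ (ModelFrobenioid.unit g)) (L ^ k) hcompat
    have hβ : ((primToPerfQ p).β.app (op ⟨PUnit.unit⟩)).hom us = ModelFrobenioid.unit g := by
      apply (qpPerfDatum p).resK_ext ⟨PUnit.unit⟩
      · exact hus₁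
      · have hc := (primToPerfQ p).comm (op ⟨PUnit.unit⟩) us
        change gpApp (primToPerfQ p).η (op ⟨PUnit.unit⟩) _ =
          Literature.AlgebraicGeometry.Frobenioids.divB (qpPerfDatum p).Φ (qpPerfDatum p).B (qpPerfDatum p).divB
            (op ⟨PUnit.unit⟩) (((primToPerfQ p).β.app (op ⟨PUnit.unit⟩)).hom us) at hc
        rw [← hc, hus₂, gpApp_η_logpQ_zpow, hdivB]
    -- the relation of the preimage `(d, id, log(p)^n, us)` in `Φ⊢^gp = log(p)^ℤ`
    have hcXd : cX ^ (d : ℕ) * L ^ (n : ℤ) = cX' * L ^ k := by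
      rw [hi, hi', ← hL, ← hmn, ← zpow_natCast, ← zpow_mul, ← zpow_add, ← zpow_add]
      congr 1
      ring
    have hrel' : cX ^ (d : ℕ) * Algebra.GrothendieckGroup.of (logpQ p ⟨PUnit.unit⟩ ^ n) =
        pullGp (qpPrimDatum p).Φ (𝟙 (⟨PUnit.unit⟩ : Discrete PUnit.{1})) cX' *
          Literature.AlgebraicGeometry.Frobenioids.divB (qpPrimDatum p).Φ (qpPrimDatum p).B (qpPrimDatum p).divB
            (op ⟨PUnit.unit⟩) us := by
      rw [pullGp_id, hus₂, map_pow, ← hL, ← zpow_natCast L n]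
      exact hcXd
    let s : (⟨⟨PUnit.unit⟩, cX⟩ : (qpPrimDatum p).frobenioid) ⟶ ⟨⟨PUnit.unit⟩, cX'⟩ :=
      ⟨d, 𝟙 _, logpQ p ⟨PUnit.unit⟩ ^ n, us, hrel'⟩
    refine ⟨s, ?_⟩
    apply ModelFrobenioid.hom_ext
    · rfl
    · exact Subsingleton.elim _ _
    · have h3 : ModelFrobenioid.div ((ofKitQp p).CdashToC.map s) =
          ((qpPerfDatum p).Φ.map (𝟙 (⟨PUnit.unit⟩ : Discrete PUnit.{1})).op).hom
            (((primToPerfQ p).η.app (op ⟨PUnit.unit⟩)).hom (logpQ p ⟨PUnit.unit⟩ ^ n)) := rfl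
      rw [h3, ModelFrobenioid.map_id_apply_Φ, map_pow, inclusionη_logpQ, hn]
      exact Subtype.ext rfl
    · have h4 : ModelFrobenioid.unit ((ofKitQp p).CdashToC.map s) =
          ((qpPerfDatum p).B.map (𝟙 (⟨PUnit.unit⟩ : Discrete PUnit.{1})).op).hom
            (((primToPerfQ p).β.app (op ⟨PUnit.unit⟩)).hom us) := rfl
      rw [h4, ModelFrobenioid.map_id_apply_B, hβ]

/-! ### Every self-equivalence of `C_v` preserves the image of `C⊢_v` ([FrdI] Thm. 3.4 (iii)) -/

/-- An image object `(A, log(p)^i)` carries an ISOMETRIC endomorphism of Frobenius degree `2`: `(2, id, 0, u)` with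
`Div_B(u) = log(p)^i`. [cite: MochizukiFrdI2008, Thm. 5.2(i) p.100] -/
theorem exists_isometry_two (Z : (qpPerfDatum p).frobenioid) {i : ℤ}
    (hZ : Z.cls = Algebra.GrothendieckGroup.of (pGen p Z.base) ^ i) :
    ∃ φ : Z ⟶ Z, ModelFrobenioid.degFr φ = 2 ∧ ModelFrobenioid.div φ = 1 := by
  have hcompat : divZeroHom ℚ_[p] (pU p ^ i) =
      MonGp.map ((qpPerfDatum p).ιHom Z.base) (Algebra.GrothendieckGroup.of (pGen p Z.base) ^ i) := by
    rw [map_zpow, map_zpow]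
    exact congrArg (· ^ i) (divZeroHom_pU p Z.base)
  obtain ⟨u, -, hu⟩ := (qpPerfDatum p).exists_B_of_compat (op Z.base) (pU p ^ i)
    (Algebra.GrothendieckGroup.of (pGen p Z.base) ^ i) hcompat
  refine ⟨⟨2, 𝟙 _, 1, u, ?_⟩, rfl, rfl⟩
  rw [map_one, mul_one, pullGp_id, hu, hZ, ← zpow_natCast, ← zpow_mul, ← zpow_add]
  congr 1
  change i * 2 = i + i
  ring

/-- **Essential-image invariance**: for every self-equivalence `e` of `C_v = C(ℚ_p)` and every `X₀ ∈ C⊢_v`, the object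
`e(X₀)` is again (isomorphic to) an object of `C⊢_v` — [FrdI] Thm. 3.4 (iii): `e` carries the degree-`2` isometry of `X₀`
to a degree-`2` isometry of `e(X₀)`, whose class is therefore integral. [cite: MochizukiFrdI2008, Thm. 3.4 (iii) p.62] -/
theorem essImage_invariant (e : (ofKitQp p).Cv ≌ (ofKitQp p).Cv) (X₀ : (ofKitQp p).Cdash) :
    (ofKitQp p).CdashToC.essImage (e.functor.obj ((ofKitQp p).CdashToC.obj X₀)) := by
  -- [FrdI] Thm. 3.4 (iii) over the FSM-type one-object base, for the Frobenioid of standard type `C(ℚ_p)`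
  have hstd := padicFrobenioid_stdHyp (qpPerfDatum p) PadicFrd.isOfFSMType_discretePUnit e
  have hng : ∃ A : (qpPerfDatum p).frobenioid,
      ¬ (PreFrobenioidData.ofFunctor (qpPerfDatum p).Φ (qpPerfDatum p).structureFunctor).IsGroupLikeObj A :=
    ⟨(ofKitQp p).CdashToC.obj X₀, (qpPerfDatum p).thm12_not_isGroupLikeObj _⟩
  have hf := FrdI.Thm34Sub.fsmHyp_of_stdHyp _ _ e hstd hng hng
  have hiso := (FrdI.Thm34Sub.l01_morphismsPreserved_FSM_holds _ _ e hf).2.2.2.2.2.1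
  obtain ⟨ΨN, hΨN, hN⟩ := FrdI.Thm34Sub.l07_psiN_nonGroupLike_holds _ _ e hf
  -- the degree-2 isometry of the image object and its image under `e`
  obtain ⟨i, hi⟩ := prim_gp_eq_zpow p X₀.base X₀.cls
  have hZ := cdashToC_obj_cls_eq_zpow p X₀ hi
  obtain ⟨φ, hφd, hφi⟩ := exists_isometry_two p ((ofKitQp p).CdashToC.obj X₀) hZ
  have hψd : ModelFrobenioid.degFr (e.functor.map φ) = 2 := by
    have h := hΨN φ
    rw [hN] at h
    change ModelFrobenioid.degFr (e.functor.map φ) = ModelFrobenioid.degFr φ at h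
    rw [h, hφd]
  have hψi : ModelFrobenioid.div (e.functor.map φ) = 1 := hiso φ hφi
  -- hence the class of `e(X₀)` is integral
  have hcls := cls_eq_divB_of_isometry_two p (e.functor.map φ) hψd hψi
  rw [divB_eq_pGen_zpow] at hcls
  exact mem_essImage_of_cls_eq_zpow p _ _ hcls

/-! ### Example 3.3 (iii) (d) at `ofKitQp p` -/

/-- **[IUTchI] Ex. 3.3 (iii) (d) HOLDS at the real instance `ofKitQp p`**: "the category `C⊢_v` may be reconstructed
category-theoretically from `F̲_v`" — every self-equivalence of the REAL `C(ℚ_p)` lifts compatibly along `C⊢(ℚ_p) ⊆ C(ℚ_p)`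
(`ReconstructibleAlong`), by fullness of the inclusion at `ℚ_p` and [FrdI] Thm. 3.4 (iii) (essential-image invariance),
through the criterion `reconstructibleAlong_of_essImage_invariant`. [claim: Mochizuki2012, status: disputed] -/
theorem cdashFromF_ofKitQp : (ofKitQp p).CdashFromF := by
  haveI := cdashToC_full p
  exact reconstructibleAlong_of_essImage_invariant (ofKitQp p).CdashToC (essImage_invariant p)

/-- **Ex. 3.3 (iii) at the witness `ofKitQp p`: (a)(b)(c)(d) HOLD, (e) FAILS** — the four clauses printed with
Frobenioid-theoretic / trivial-base justifications are kernel theorems of the real [FrdII] objects over the point, and the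
one clause whose printed justification is anabelian ([AbsTopIII] Prop. 3.2 (iii): the ELEMENT `p_v`) is false there.
[claim: Mochizuki2012, status: disputed] -/
theorem ex33iii_abcd_not_e_ofKitQp :
    (ofKitQp p).DdashFromD ∧ (ofKitQp p).BasesFromC ∧ (ofKitQp p).DFromF ∧ (ofKitQp p).CdashFromF ∧
      ¬ (ofKitQp p).SplitFromF :=
  ⟨ddashFromD_ofKitQp p, basesFromC_ofKitQp p, dFromF_ofKitQp p, cdashFromF_ofKitQp p, not_splitFromF_ofKitQp p⟩

end GoodLocalFrobenioid

end Literature.IUT.HodgeTheaters
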